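import Summits.CriticalPhenomena.PercolationContinuityZ3.Theorems.FK.PartitionFunctionDecomposition
import Literature.Probability.LatticeModels.IsingThermodynamicsProofs
import HarnessLib

/-!
# FK-continuity cell, FO-10a (pressure layer, file 3): cube estimates for the random-cluster pressure on `ℤ^d` — a priori bound,
# tiling estimate, layer estimate and the Cauchy estimate (Grimmett 2006, proof of Thm. (4.58), (4.65)–(4.66))

Registered R83 (cell INBOX l.6084, 2026-08-24); registry row FO-10a-g338; label PRS-C (coordinator fk-4 g187).
Cell `fk-continuity` (bschramm), row FO-10a (domain-Markov + comparison layer over FO-06); support file for the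
FK-continuity transplant (`--supports stmt-CriticalPhenomena-4575`); builds on p205010 (kernel theorem, internal audit
signed; external expert review pending). Pure proofs; no definitions, no named facts, no sorries; general `d`.
UNCONDITIONAL finite-volume structure; it decides nothing about FH / TP_FK / the value of `p_c(q)`.

For `q ≥ 1`, `0 ≤ p ≤ 1` and the cubes `C_n = {0,…,n-1}^d = halfOpenBox d n` of `ℤ^d`, with
`Z⁰_{C_n} = rcPartitionFunction (finsetGraph (zdGraph d) (halfOpenBox d n)) p q ∅`, the finite-volume estimates of Grimmett's proof of
Thm. (4.58) ("a standard argument of statistical mechanics, namely the near-multiplicativity"), organised exactly as the tree's proof of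
Friedli–Velenik Thm. 3.6 for the Ising model (`IsingThermodynamicsProofs.lean`, whose lattice tiling lemmas `halfOpenBox_mul_eq_biUnion`,
`disjoint_map_shift_halfOpenBox`, `card_edgeBoundary_map_shift_halfOpenBox_le`, … are reused verbatim), with the seam cost `log q` per
boundary edge (`PartitionFunctionDecomposition.lean`) in place of `|β|`:

* `log_rcPartitionFunction_halfOpenBox_mem_Icc` — a priori `0 ≤ log Z⁰_{C_n} ≤ n^d log q`;
* **`abs_log_rcPartitionFunction_halfOpenBox_mul_sub_le`** — tiling `|log Z⁰_{C_{kn}} - k^d log Z⁰_{C_n}| ≤ k^d 2d((n+2)^d - n^d) log q`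
  (Grimmett's (4.65), `⌊n/k⌋^d` translates of `Λ_k`);
* **`abs_log_rcPartitionFunction_halfOpenBox_sub_le`** — layers `|log Z⁰_{C_m} - log Z⁰_{C_{m'}}| ≤ (1 + 2d)(m^d - m'^d) log q`
  (Grimmett's bound on `log Z_{Λ_n ∖ Λ_{(n,k)}}`);
* **`abs_log_rcPartitionFunction_halfOpenBox_div_sub_le`** — the Cauchy estimate: with `ψ_n = n^{-d} log Z⁰_{C_n}`, for `1 ≤ n ≤ m`,
  `|ψ_m - ψ_n| ≤ (2 + 2d) d log q · n/m + 2d((n+2)^d - n^d) n^{-d} log q`.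

The companion `PressureThermodynamicLimit.lean` draws the limit (cubes, boxes, both boundary conditions).

Honest framing: finite-volume inequalities; no statement about `p_c(q)`; NOT a binder discharge, NOT `_r4`.

## References

* G. Grimmett, *The Random-Cluster Model*, Springer 2006 (`book:grimmett2006-random-cluster-model`): §4.5, Thm. (4.58) and its
  proof, (4.65)–(4.66) [PDF pp. 88–92]; Thm. (3.63). [Grimmett2006]
* S. Friedli, Y. Velenik, *Statistical Mechanics of Lattice Systems*, CUP 2017, Thm. 3.6 (the template of the argument).
  [FriedliVelenik2017]
-/

noncomputable section

open Finset Filter Topology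

namespace Summit.CriticalPhenomena.PercolationContinuityZ3.Theorems.FK

open Literature.Probability.Percolation Literature.Probability.LatticeModels

variable (d : ℕ)

/-! ### Cubes: a priori bound, tiling estimate, layer estimate -/

section Cubes

/-- **A priori bound for cubes**: `0 ≤ log Z⁰_{C_n} ≤ n^d log q`, `C_n = {0,…,n-1}^d` (Grimmett 2006, (3.59): `1 ≤ Z ≤ q^{|V|}`).
[cite: Grimmett2006, §3.6 (3.59)] -/
theorem log_rcPartitionFunction_halfOpenBox_mem_Icc {p q : ℝ} (hp : p ∈ Set.Icc (0 : ℝ) 1) (hq : 1 ≤ q) (n : ℕ) :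
    Real.log (rcPartitionFunction (finsetGraph (zdGraph d) (halfOpenBox d n)) p q ∅) ∈
      Set.Icc 0 ((n : ℝ) ^ d * Real.log q) := by
  have h := log_rcPartitionFunction_finsetGraph_mem_Icc (zdGraph d) hp hq (halfOpenBox d n) ∅
  rw [card_halfOpenBox] at h
  push_cast at h
  exact h

/-- **Tiling estimate** (Grimmett 2006, proof of Thm. (4.58), (4.65): `log Z_{Λ_n}` against `⌊n/k⌋^d` translates of
`log Z_{Λ_k}` up to the seams; here for the cube `C_{kn}` tiled by `k^d` translates of `C_n`): for `n ≥ 1` and every `k`,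
`|log Z⁰_{C_{kn}} - k^d log Z⁰_{C_n}| ≤ k^d · 2d((n+2)^d - n^d) · log q`. [cite: Grimmett2006, proof of Thm. (4.58), (4.65)] -/
theorem abs_log_rcPartitionFunction_halfOpenBox_mul_sub_le {p q : ℝ} (hp : p ∈ Set.Icc (0 : ℝ) 1) (hq : 1 ≤ q)
    (k : ℕ) {n : ℕ} (hn : 0 < n) :
    |Real.log (rcPartitionFunction (finsetGraph (zdGraph d) (halfOpenBox d (k * n))) p q ∅) -
        (k : ℝ) ^ d * Real.log (rcPartitionFunction (finsetGraph (zdGraph d) (halfOpenBox d n)) p q ∅)| ≤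
      Real.log q * ((k : ℝ) ^ d * (2 * d * (((n : ℝ) + 2) ^ d - (n : ℝ) ^ d))) := by
  set T : Site d → Finset (Site d) := fun v =>
    (halfOpenBox d n).map (Site.shift ((n : ℤ) • v)).toEmbedding with hT
  have hdis : ∀ v ∈ halfOpenBox d k, ∀ w ∈ halfOpenBox d k, v ≠ w → Disjoint (T v) (T w) :=
    fun v _ w _ hvw => disjoint_map_shift_halfOpenBox hn hvw
  have hmain := abs_log_rcPartitionFunction_finsetGraph_biUnion_sub_sum_le (zdGraph d) hp hq
    (halfOpenBox d k) T hdis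
  rw [← halfOpenBox_mul_eq_biUnion d k hn] at hmain
  have hZ : ∀ v, Real.log (rcPartitionFunction (finsetGraph (zdGraph d) (T v)) p q ∅) =
      Real.log (rcPartitionFunction (finsetGraph (zdGraph d) (halfOpenBox d n)) p q ∅) := fun v => by
    rw [hT, rcPartitionFunction_finsetGraph_map_shift]
  have hsum : ∑ v ∈ halfOpenBox d k, Real.log (rcPartitionFunction (finsetGraph (zdGraph d) (T v)) p q ∅) =
      (k : ℝ) ^ d * Real.log (rcPartitionFunction (finsetGraph (zdGraph d) (halfOpenBox d n)) p q ∅) := by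
    rw [Finset.sum_congr rfl fun v _ => hZ v, Finset.sum_const, card_halfOpenBox, nsmul_eq_mul]
    push_cast
    ring
  have hle : n ^ d ≤ (n + 2) ^ d := Nat.pow_le_pow_left (by omega) d
  have hB : ∀ v, (#(edgeBoundary (zdGraph d) (T v)) : ℝ) ≤ 2 * d * (((n : ℝ) + 2) ^ d - (n : ℝ) ^ d) := by
    intro v
    have := card_edgeBoundary_map_shift_halfOpenBox_le ((n : ℤ) • v) n (d := d)
    have hcast : ((2 * d * ((n + 2) ^ d - n ^ d) : ℕ) : ℝ) = 2 * d * (((n : ℝ) + 2) ^ d - (n : ℝ) ^ d) := by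
      push_cast [Nat.cast_sub hle]
      ring
    rw [← hcast]
    exact_mod_cast this
  have hsumB : ∑ v ∈ halfOpenBox d k, (#(edgeBoundary (zdGraph d) (T v)) : ℝ) ≤
      (k : ℝ) ^ d * (2 * d * (((n : ℝ) + 2) ^ d - (n : ℝ) ^ d)) := by
    refine (Finset.sum_le_sum fun v _ => hB v).trans ?_
    rw [Finset.sum_const, card_halfOpenBox, nsmul_eq_mul]
    push_cast
    rfl
  rw [hsum] at hmain
  refine hmain.trans ?_
  rw [mul_comm]
  exact mul_le_mul_of_nonneg_left hsumB (Real.log_nonneg hq)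

/-- **Layer estimate** (Grimmett 2006, proof of Thm. (4.58): the bound on `log Z_{Λ_n ∖ Λ_{(n,k)}}` by the volume of the
layer): for `m' ≤ m`, `|log Z⁰_{C_m} - log Z⁰_{C_{m'}}| ≤ (log q + 2d log q)(m^d - m'^d)` (decompose `C_m = C_{m'} ⊔ S`,
`|S| = m^d - m'^d`, `|∂ᵉS| ≤ 2d|S|`, `0 ≤ log Z⁰_S ≤ |S| log q`). [cite: Grimmett2006, proof of Thm. (4.58), (4.65)–(4.66)] -/
theorem abs_log_rcPartitionFunction_halfOpenBox_sub_le {p q : ℝ} (hp : p ∈ Set.Icc (0 : ℝ) 1) (hq : 1 ≤ q)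
    {m' m : ℕ} (hm : m' ≤ m) :
    |Real.log (rcPartitionFunction (finsetGraph (zdGraph d) (halfOpenBox d m)) p q ∅) -
        Real.log (rcPartitionFunction (finsetGraph (zdGraph d) (halfOpenBox d m')) p q ∅)| ≤
      (Real.log q + 2 * d * Real.log q) * ((m : ℝ) ^ d - (m' : ℝ) ^ d) := by
  set S := halfOpenBox d m \ halfOpenBox d m' with hS
  have hsub : halfOpenBox d m' ⊆ halfOpenBox d m := halfOpenBox_mono d hm
  have hle : m' ^ d ≤ m ^ d := Nat.pow_le_pow_left hm d
  have hcardS : (#S : ℝ) = (m : ℝ) ^ d - (m' : ℝ) ^ d := by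
    rw [hS, Finset.card_sdiff_of_subset hsub, card_halfOpenBox, card_halfOpenBox, Nat.cast_sub hle]
    push_cast
    ring
  have hlogq : 0 ≤ Real.log q := Real.log_nonneg hq
  -- the decomposition `C_m = S ∪ C_{m'}`
  have h1 := abs_log_rcPartitionFunction_finsetGraph_sub_add_le (zdGraph d) hp hq
    (Finset.sdiff_subset : S ⊆ halfOpenBox d m)
  rw [Finset.sdiff_sdiff_eq_self hsub] at h1
  -- the pieces
  have h2 : (#(edgeBoundary (zdGraph d) S) : ℝ) ≤ 2 * d * #S := by
    exact_mod_cast card_edgeBoundary_le_mul_card_of_degree_le (zdGraph d) card_incidenceFinset_zdGraph_le S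
  have h3' := log_rcPartitionFunction_finsetGraph_mem_Icc (zdGraph d) hp hq S ∅
  have h3 : |Real.log (rcPartitionFunction (finsetGraph (zdGraph d) S) p q ∅)| ≤ Real.log q * #S := by
    rw [abs_of_nonneg h3'.1, mul_comm]
    exact h3'.2
  have h4 : (#(edgeBoundary (zdGraph d) S) : ℝ) * Real.log q ≤ 2 * d * #S * Real.log q :=
    mul_le_mul_of_nonneg_right h2 hlogq
  calc |Real.log (rcPartitionFunction (finsetGraph (zdGraph d) (halfOpenBox d m)) p q ∅) -
          Real.log (rcPartitionFunction (finsetGraph (zdGraph d) (halfOpenBox d m')) p q ∅)|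
      ≤ |Real.log (rcPartitionFunction (finsetGraph (zdGraph d) (halfOpenBox d m)) p q ∅) -
            (Real.log (rcPartitionFunction (finsetGraph (zdGraph d) S) p q ∅) +
              Real.log (rcPartitionFunction (finsetGraph (zdGraph d) (halfOpenBox d m')) p q ∅))| +
          |Real.log (rcPartitionFunction (finsetGraph (zdGraph d) S) p q ∅)| := by
        have := abs_add_le
          (Real.log (rcPartitionFunction (finsetGraph (zdGraph d) (halfOpenBox d m)) p q ∅) -
            (Real.log (rcPartitionFunction (finsetGraph (zdGraph d) S) p q ∅) +
              Real.log (rcPartitionFunction (finsetGraph (zdGraph d) (halfOpenBox d m')) p q ∅)))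
          (Real.log (rcPartitionFunction (finsetGraph (zdGraph d) S) p q ∅))
        refine le_trans (le_of_eq ?_) this
        congr 1; ring
    _ ≤ 2 * d * #S * Real.log q + Real.log q * #S := add_le_add (h1.trans h4) h3
    _ = (Real.log q + 2 * d * Real.log q) * ((m : ℝ) ^ d - (m' : ℝ) ^ d) := by
        rw [← hcardS]; ring

end Cubes

/-! ### Existence of the limit along cubes: the Cauchy estimate -/

section Limit

/-- **The Cauchy estimate for the pressure of cubes** (Grimmett 2006, proof of Thm. (4.58), (4.65)–(4.66), merged as in the
tree's proof of Friedli–Velenik Thm. 3.6): writing `ψ_n = log Z⁰_{C_n} / n^d`, for `1 ≤ n ≤ m`,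
`|ψ_m - ψ_n| ≤ (2 log q + 2d log q) d · n/m + log q · 2d((n+2)^d - n^d)/n^d` (tile `C_m ⊇ C_{kn}`, `k = ⌊m/n⌋`, by `k^d`
translates of `C_n`; tiling estimate, layer estimate for `C_m ∖ C_{kn}` with `m^d - (kn)^d ≤ d n m^{d-1}`, a priori bound).
[cite: Grimmett2006, proof of Thm. (4.58), (4.65)–(4.66)] -/
theorem abs_log_rcPartitionFunction_halfOpenBox_div_sub_le {p q : ℝ} (hp : p ∈ Set.Icc (0 : ℝ) 1) (hq : 1 ≤ q)
    {n m : ℕ} (hn : 1 ≤ n) (hnm : n ≤ m) :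
    |Real.log (rcPartitionFunction (finsetGraph (zdGraph d) (halfOpenBox d m)) p q ∅) / (m : ℝ) ^ d -
        Real.log (rcPartitionFunction (finsetGraph (zdGraph d) (halfOpenBox d n)) p q ∅) / (n : ℝ) ^ d| ≤
      (2 * Real.log q + 2 * d * Real.log q) * d * ((n : ℝ) / m) +
        Real.log q * (2 * d * (((n : ℝ) + 2) ^ d - (n : ℝ) ^ d)) / (n : ℝ) ^ d := by
  -- the integer `k = ⌊m/n⌋` and the three volumes
  obtain ⟨k, hk⟩ : ∃ k, k = m / n := ⟨_, rfl⟩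
  have hn0 : 0 < n := hn
  have hkn_le : k * n ≤ m := by rw [hk]; exact Nat.div_mul_le_self m n
  have hm_lt : m < k * n + n := by
    have h1 : m < n * (m / n + 1) := Nat.lt_mul_div_succ m hn0
    have h2 : n * (m / n + 1) = k * n + n := by rw [hk]; ring
    omega
  -- the constants and the logarithms
  set K₀ : ℝ := Real.log q with hK₀
  set B : ℝ := 2 * d * (((n : ℝ) + 2) ^ d - (n : ℝ) ^ d) with hB
  set am := Real.log (rcPartitionFunction (finsetGraph (zdGraph d) (halfOpenBox d m)) p q ∅) with ham
  set ak := Real.log (rcPartitionFunction (finsetGraph (zdGraph d) (halfOpenBox d (k * n))) p q ∅) with hak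
  set an := Real.log (rcPartitionFunction (finsetGraph (zdGraph d) (halfOpenBox d n)) p q ∅) with han
  -- real-number bookkeeping
  have hN : (0 : ℝ) < n := by exact_mod_cast hn0
  have hM : (0 : ℝ) < m := by exact_mod_cast lt_of_lt_of_le hn0 hnm
  have hNd : (0 : ℝ) < (n : ℝ) ^ d := pow_pos hN d
  have hMd : (0 : ℝ) < (m : ℝ) ^ d := pow_pos hM d
  have hKN_le : (k : ℝ) * n ≤ m := by exact_mod_cast hkn_le
  have hM_lt : (m : ℝ) < k * n + n := by exact_mod_cast hm_lt
  have hK0 : (0 : ℝ) ≤ k := Nat.cast_nonneg k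
  have hK₀0 : 0 ≤ K₀ := Real.log_nonneg hq
  have hB0 : 0 ≤ B := by
    have : (n : ℝ) ^ d ≤ ((n : ℝ) + 2) ^ d := pow_le_pow_left₀ hN.le (by linarith) d
    rw [hB]
    exact mul_nonneg (by positivity) (by linarith)
  set x : ℝ := (k : ℝ) * n / m with hx
  have hx0 : 0 ≤ x := by positivity
  have hx1 : x ≤ 1 := by rw [hx, div_le_one hM]; exact hKN_le
  have hxd0 : 0 ≤ x ^ d := pow_nonneg hx0 d
  have hxd1 : x ^ d ≤ 1 := pow_le_one₀ hx0 hx1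
  have h1x : 1 - x ≤ (n : ℝ) / m := by
    have e : 1 - x = ((m : ℝ) - k * n) / m := by rw [hx]; field_simp
    rw [e]
    exact div_le_div_of_nonneg_right (by linarith) hM.le
  have hbern : 1 - x ^ d ≤ d * (1 - x) := by
    have hb := one_add_mul_le_pow (show (-2 : ℝ) ≤ x - 1 by linarith) d
    have e : 1 + (x - 1) = x := by ring
    rw [e] at hb
    linarith
  have hgap : 1 - x ^ d ≤ d * ((n : ℝ) / m) :=
    hbern.trans (mul_le_mul_of_nonneg_left h1x (Nat.cast_nonneg d))
  have hxd_eq : x ^ d = ((k : ℝ) * n) ^ d / (m : ℝ) ^ d := by rw [hx, div_pow]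
  -- the three finite-volume estimates
  have E2 : |am - ak| ≤ (K₀ + 2 * d * K₀) * ((m : ℝ) ^ d - ((k : ℝ) * n) ^ d) := by
    have := abs_log_rcPartitionFunction_halfOpenBox_sub_le d hp hq hkn_le
    push_cast at this
    exact this
  have E1 : |ak - (k : ℝ) ^ d * an| ≤ K₀ * ((k : ℝ) ^ d * B) :=
    abs_log_rcPartitionFunction_halfOpenBox_mul_sub_le d hp hq k hn0
  have E0 : |an| ≤ K₀ * (n : ℝ) ^ d := by
    have h := log_rcPartitionFunction_halfOpenBox_mem_Icc d hp hq n
    rw [han, abs_of_nonneg h.1, hK₀, mul_comm]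
    exact h.2
  -- the algebraic decomposition of `ψ_m - ψ_n`
  have hid : am / (m : ℝ) ^ d - an / (n : ℝ) ^ d =
      (am - ak) / (m : ℝ) ^ d + (ak - (k : ℝ) ^ d * an) / (m : ℝ) ^ d +
        an / (n : ℝ) ^ d * (x ^ d - 1) := by
    rw [hxd_eq, mul_pow]
    field_simp
    ring
  -- term by term
  have T1 : |(am - ak) / (m : ℝ) ^ d| ≤ (K₀ + 2 * d * K₀) * (1 - x ^ d) := by
    rw [abs_div, abs_of_pos hMd]
    refine (div_le_div_of_nonneg_right E2 hMd.le).trans (le_of_eq ?_)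
    rw [hxd_eq]
    field_simp
  have T2 : |(ak - (k : ℝ) ^ d * an) / (m : ℝ) ^ d| ≤ K₀ * B / (n : ℝ) ^ d := by
    rw [abs_div, abs_of_pos hMd]
    refine (div_le_div_of_nonneg_right E1 hMd.le).trans ?_
    have e : K₀ * ((k : ℝ) ^ d * B) / (m : ℝ) ^ d = K₀ * B / (n : ℝ) ^ d * x ^ d := by
      rw [hxd_eq, mul_pow]
      field_simp
    rw [e]
    exact mul_le_of_le_one_right (by positivity) hxd1
  have T3 : |an / (n : ℝ) ^ d * (x ^ d - 1)| ≤ K₀ * (1 - x ^ d) := by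
    rw [abs_mul, abs_div, abs_of_pos hNd, abs_sub_comm,
      abs_of_nonneg (show (0 : ℝ) ≤ 1 - x ^ d by linarith)]
    refine mul_le_mul_of_nonneg_right ?_ (show (0 : ℝ) ≤ 1 - x ^ d by linarith)
    rw [div_le_iff₀ hNd]
    exact E0
  -- conclusion
  rw [hid]
  have hsum := (abs_add_le _ _).trans (add_le_add (abs_add_le _ _) le_rfl)
    |>.trans (add_le_add (add_le_add T1 T2) T3)
  have hfin : (K₀ + 2 * d * K₀) * (1 - x ^ d) + K₀ * B / (n : ℝ) ^ d + K₀ * (1 - x ^ d) ≤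
      (2 * K₀ + 2 * d * K₀) * d * ((n : ℝ) / m) + K₀ * B / (n : ℝ) ^ d := by
    have h2K : (0 : ℝ) ≤ 2 * K₀ + 2 * d * K₀ :=
      add_nonneg (mul_nonneg zero_le_two hK₀0) (mul_nonneg (mul_nonneg zero_le_two (Nat.cast_nonneg d)) hK₀0)
    have : (2 * K₀ + 2 * d * K₀) * (1 - x ^ d) ≤ (2 * K₀ + 2 * d * K₀) * (d * ((n : ℝ) / m)) :=
      mul_le_mul_of_nonneg_left hgap h2K
    linarith
  exact hsum.trans hfin

end Limit

end Summit.CriticalPhenomena.PercolationContinuityZ3.Theorems.FK
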